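import Literature.NumberTheory.Rogawski1990.ArchInnerFormSemiregularProper      -- ★ p850279 (J-DESC) D4b-1: `uniformlyProper_gprimeBlock_cpt_of_injective`, `gprimeTorus_eq_symm_blockChart`; brings ★ D4a `uniformlyProper_arch_of_places`
import Literature.NumberTheory.Automorphic.ArchInnerFormChartMeasures            -- ★ `chartTorusG`, `chartTorusG_eq_centralizer`, `forall_mem_chartTorusG_comm`, `chartQuotientMeasureG`
import Literature.MeasureTheory.Group.OrbitalDescentChartTorus                   -- ★ p850136 (J-DESC) D3 §1: `integrable_descConj_of_exists_isCompact`
import Literature.NumberTheory.Rogawski1990.ArchInnerFormSplitPlaceProper        -- ★ p850470 (J-DESC) SPLIT-DOCK (ED. 2): `uniformlyProper_gprimeTorus_of_regular` (split-chart places at their regular points)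
import HarnessLib

/-!
# The chart integrand of `chartOrbG` on the compact atlas `S′ = ∅` is integrable at every regular point (the `Integrable` binder of ★ `exists_descended_chartOrbG_eq`, discharged)
# (Rogawski 1990 §8.3 p. 122; Deitmar–Echterhoff 2014 Lemma 9.3.3; Harish-Chandra–van Dijk 1970 Part I §3 Lemma 22)

Topic `NumberTheory/Rogawski1990`; namespace `Literature.NumberTheory.Rogawski1990`.  THEOREMS ONLY (no `def`, no instance, no notation, no axiom, no named fact, no `sorry`).
Cell `pub/hodgecm-mathlib`, crux H413 (`stmt-HodgeConjecture-24833`), F0∕P3c line LH3 (closer stub `stub_N9`, organ J), brick **(J-DESC) FILE D4b-3** (seat F0P3a-p08 (g22)): for the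
ALL-COMPACT chart `S′ = ∅` (the chart of the N-2 instance «`S = ∅`, one covered wall» of organ J, compact-wall side) the hypothesis
`Integrable (descConj (gprimeTorus c) (chartTorusG ∅) _ a′) (chartQuotientMeasureG …)` of ★ D4b-2 `exists_descended_chartOrbG_eq` ∕ `chartOrbG_eq_integral_descended_of_cutoff` holds at
every `c ∈ RegG ∅` and every measure finite on compact sets: at a regular point the chart is uniformly proper modulo `Z(gprimeTorus ∅ c)` (★ (W1-cont-Π) §2 at every place through
★ D4b-1 `uniformlyProper_gprimeBlock_cpt_of_injective`, assembled by ★ D4a), `Z(gprimeTorus ∅ c) = T_∅ = chartTorusG ∅` (★ `chartTorusG_eq_centralizer`), and (HYP) at ONE point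
⇒ the integrand is `C_c` on `G′_∞ ⧸ T_∅` (★ D3 §1 `integrable_descConj_of_exists_isCompact`).  Charts with split places need in addition the (W1-cont) split-place dock
(★ `uniformlyProper_centralizer_map_of_diag_hyperbolic` through an atlas frame) and are NOT treated here.
* `uniformlyProper_gprimeTorus_empty_regG` — (HYP) for `c ↦ gprimeTorus L α ∅ c` modulo `Z(gprimeTorus ∅ c₀)` on `Set.pi univ (injective angles)`, any `c₀`;
* **`integrable_descConj_gprimeTorus_empty_of_regG`** — the binder, discharged.
HONEST LABEL: HC_CM is proved only modulo the 7 printed citations (2 remaining named inputs: hLiu418 = `stmt-HodgeConjecture-24832`, h413 = `stmt-HodgeConjecture-24833`) until rung 0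
closes; count-neutral bookkeeping under organ J of `stub_N9`.

## References
* [Rogawski1990] J. D. Rogawski, *Automorphic Representations of Unitary Groups in Three Variables*, Ann. of Math. Stud. 123 (1990), §8.3 p. 122 (orbital integrals of `C_c`
  functions converge on `T_reg`), §4.3 p. 43, §3.6 p. 31.
* [DeitmarEchterhoff2014] A. Deitmar, S. Echterhoff, *Principles of Harmonic Analysis*, 2nd ed. (2014), Lemma 9.3.3.
* [HarishChandra1970] Harish-Chandra (notes by G. van Dijk), *Harmonic Analysis on Reductive p-adic Groups*, LNM 162 (1970), Part I §3 Lemma 22.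
-/

set_option autoImplicit false

noncomputable section

open MeasureTheory Set Topology NumberField NumberField.InfinitePlace
open Literature.MeasureTheory.Group Literature.NumberTheory.Automorphic Literature.NumberTheory.Automorphic.UnitaryGroup
open scoped MatrixGroups Matrix Pointwise

namespace Literature.NumberTheory.Rogawski1990

section Empty

variable (L : Type) [Field L] [NumberField L] [IsCMField L] (α : Fin 3 → L)

/-- **(HYP) for the all-compact atlas `gprimeTorus α ∅` on the product of the injective-angle sets, modulo `Z(gprimeTorus ∅ c₀)`** for ANY coordinate `c₀` (the chart torus
centralises every chart point; the per-place modulus `Z(gprimeBlock c₀ w)` is arbitrary in ★ `uniformlyProper_gprimeBlock_cpt_of_injective`).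
[cite: Rogawski1990, §8.3 p. 122; §4.3 p. 43] [cite: DeitmarEchterhoff2014, Lemma 9.3.3] -/
theorem uniformlyProper_gprimeTorus_empty (hα : ∀ i, α i ≠ 0) (c₀ : {w : InfinitePlace L // IsComplex w} → Fin 3 → ℝ) :
    ∀ K ⊆ Set.pi Set.univ (fun _ : {w : InfinitePlace L // IsComplex w} => {cw : Fin 3 → ℝ | Function.Injective fun i : Fin 3 => Circle.exp (cw i)}), IsCompact K →
      ∀ C' : Set ↥(arch (↥(maximalRealSubfield L)) L (IsCMField.complexConj L) 3 (Matrix.diagonal α)), IsCompact C' →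
        ∃ 𝒦' : Set (↥(arch (↥(maximalRealSubfield L)) L (IsCMField.complexConj L) 3 (Matrix.diagonal α)) ⧸
            Subgroup.centralizer ({gprimeTorus L α ∅ c₀} : Set ↥(arch (↥(maximalRealSubfield L)) L (IsCMField.complexConj L) 3 (Matrix.diagonal α)))),
          IsCompact 𝒦' ∧ ∀ c ∈ K, ∀ y' : ↥(arch (↥(maximalRealSubfield L)) L (IsCMField.complexConj L) 3 (Matrix.diagonal α)),
            y' * gprimeTorus L α ∅ c * y'⁻¹ ∈ C' →
              (QuotientGroup.mk y' : ↥(arch (↥(maximalRealSubfield L)) L (IsCMField.complexConj L) 3 (Matrix.diagonal α)) ⧸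
                Subgroup.centralizer ({gprimeTorus L α ∅ c₀} : Set ↥(arch (↥(maximalRealSubfield L)) L (IsCMField.complexConj L) 3 (Matrix.diagonal α)))) ∈ 𝒦' := by
  have hMM' : ∀ g : ∀ w : {w : InfinitePlace L // IsComplex w}, ↥(archLocal L 3 (Matrix.diagonal α) w),
      (archPiEquivCM 3 L (Matrix.diagonal α)).symm g ∈
          Subgroup.centralizer ({gprimeTorus L α ∅ c₀} : Set ↥(arch (↥(maximalRealSubfield L)) L (IsCMField.complexConj L) 3 (Matrix.diagonal α))) ↔
        g ∈ Subgroup.pi Set.univ fun w => Subgroup.centralizer ({gprimeBlock L α w ∅ c₀} : Set ↥(archLocal L 3 (Matrix.diagonal α) w)) :=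
    fun g => by
      rw [gprimeTorus, show ((archPiEquivCM 3 L (Matrix.diagonal α)).symm g) = (archPiEquivCM 3 L (Matrix.diagonal α)).symm.toMulEquiv g from rfl,
        show ((archPiEquivCM 3 L (Matrix.diagonal α)).symm fun w => gprimeBlock L α w ∅ c₀) =
          (archPiEquivCM 3 L (Matrix.diagonal α)).symm.toMulEquiv (fun w => gprimeBlock L α w ∅ c₀) from rfl,
        mulEquiv_apply_mem_centralizer_singleton_iff, Subgroup.mem_centralizer_singleton_iff, Subgroup.mem_pi]
      simp only [Set.mem_univ, true_imp_iff, Subgroup.mem_centralizer_singleton_iff]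
      exact ⟨fun h w => congrFun h w, fun h => funext h⟩
  have hcpt : ∀ w : {w : InfinitePlace L // IsComplex w}, ¬ (w ∈ (∅ : Finset {w : InfinitePlace L // IsComplex w}) ∧ w ∈ splitChartPlaces L α) :=
    fun w h => Finset.notMem_empty w h.1
  exact uniformlyProper_arch_of_places L 3 (Matrix.diagonal α) (fun w => Subgroup.centralizer ({gprimeBlock L α w ∅ c₀} : Set ↥(archLocal L 3 (Matrix.diagonal α) w)))
    (Subgroup.centralizer ({gprimeTorus L α ∅ c₀} : Set _)) hMM' (fun w cw => gprimeBlock L α w ∅ (fun _ => cw))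
    (fun _ => {cw : Fin 3 → ℝ | Function.Injective fun i : Fin 3 => Circle.exp (cw i)})
    (fun w => uniformlyProper_gprimeBlock_cpt_of_injective L α ∅ hα (hcpt w) _)

/-- **THE CHART INTEGRAND ON THE COMPACT ATLAS IS INTEGRABLE AT REGULAR POINTS**: for `c ∈ RegG ∅`, `a′ ∈ C_c(G′_∞, E)` continuous and ANY measure `μ` on `G′_∞ ⧸ T_∅` finite on compact
sets (e.g. ★ `chartQuotientMeasureG`), `ȳ ↦ a′(y · gprimeTorus α ∅ c · y⁻¹)` is integrable — the `Integrable` binder of ★ `exists_descended_chartOrbG_eq` at `S′ = ∅`.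
[cite: Rogawski1990, §8.3 p. 122] [cite: DeitmarEchterhoff2014, Lemma 9.3.3] [cite: HarishChandra1970, Part I §3 Lemma 22] -/
theorem integrable_descConj_gprimeTorus_empty_of_regG (hα : ∀ i, α i ≠ 0) {c : {w : InfinitePlace L // IsComplex w} → Fin 3 → ℝ} (hc : c ∈ ArchCartan.RegG ∅)
    {E : Type*} [NormedAddCommGroup E] [NormedSpace ℝ E] {a' : ↥(arch (↥(maximalRealSubfield L)) L (IsCMField.complexConj L) 3 (Matrix.diagonal α)) → E}
    (ha'c : Continuous a') (ha's : HasCompactSupport a')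
    [MeasurableSpace (↥(arch (↥(maximalRealSubfield L)) L (IsCMField.complexConj L) 3 (Matrix.diagonal α)) ⧸ chartTorusG L α ∅)]
    [OpensMeasurableSpace (↥(arch (↥(maximalRealSubfield L)) L (IsCMField.complexConj L) 3 (Matrix.diagonal α)) ⧸ chartTorusG L α ∅)]
    (μ : Measure (↥(arch (↥(maximalRealSubfield L)) L (IsCMField.complexConj L) 3 (Matrix.diagonal α)) ⧸ chartTorusG L α ∅)) [IsFiniteMeasureOnCompacts μ] :
    Integrable (descConj (gprimeTorus L α ∅ c) (chartTorusG L α ∅) (forall_mem_chartTorusG_comm L α ∅ c) a') μ := by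
  -- (HYP) at the point `c` modulo `Z(gprimeTorus ∅ c)`
  have hreg : ∀ w : {w : InfinitePlace L // IsComplex w}, Function.Injective fun i : Fin 3 => Circle.exp (c w i) :=
    fun w => ((ArchCartan.mem_regG_iff ∅ c).1 hc).1 w (Finset.notMem_empty w)
  have hK : ({c} : Set ({w : InfinitePlace L // IsComplex w} → Fin 3 → ℝ)) ⊆
      Set.pi Set.univ (fun _ : {w : InfinitePlace L // IsComplex w} => {cw : Fin 3 → ℝ | Function.Injective fun i : Fin 3 => Circle.exp (cw i)}) := by
    intro x hx w _
    rw [Set.mem_singleton_iff.1 hx]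
    exact hreg w
  have h := uniformlyProper_gprimeTorus_empty L α hα c {c} hK isCompact_singleton (tsupport a') ha's.isCompact
  -- `Z(gprimeTorus ∅ c) = T_∅` at the regular point
  rw [← chartTorusG_eq_centralizer L α ∅ hα (fun w hw => absurd hw (Finset.notMem_empty w)) hc] at h
  obtain ⟨𝒦, h𝒦, hmem⟩ := h
  exact integrable_descConj_of_exists_isCompact (chartTorusG L α ∅) (isClosed_chartTorusG L α ∅) (gprimeTorus L α ∅ c)
    (forall_mem_chartTorusG_comm L α ∅ c) ha'c h𝒦 (fun y hy => hmem c (Set.mem_singleton c) y hy) μ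

end Empty

/-! ## ED. 2 — General admissible `S♯`: the binder at every point of `RegG S♯`

With ★ (J-DESC) SPLIT-DOCK `uniformlyProper_gprimeTorus_of_regular` (the split-chart places of `S♯` at their regular points `cw 0 ≠ 0`, docked to ★ (W1-cont-Π) §1) the
argument of §1 runs for EVERY admissible label `S♯ ⊆ splitChartPlaces`: the `Integrable` binder of ★ D4b-2 `exists_descended_chartOrbG_eq` ∕
`chartOrbG_eq_integral_descended_of_cutoff` and the `hintx`∕`hintν` binders of ★ (J-G′-BLOCK) ∕ (J-G′-BLOCK-β) hold at every `c ∈ RegG S♯`. -/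

section General

variable (L : Type) [Field L] [NumberField L] [IsCMField L] (α : Fin 3 → L) (S' : Finset {w : InfinitePlace L // IsComplex w})

/-- **(HYP) for the atlas `gprimeTorus α S♯` on the `RegG S♯`-box around a regular point, modulo `Z(gprimeTorus S♯ c₀)`** (`c₀ ∈ RegG S♯`): the product of the per-place
regular sets — `{cw 0 ≠ 0}` at the split-chart places of `S♯`, injective angles elsewhere. (★ SPLIT-DOCK `uniformlyProper_gprimeTorus_of_regular`.)
[cite: Rogawski1990, §8.3 p. 122; §4.12 Lemma 4.12.1 p. 66] [cite: HarishChandra1970, Part I §3 Lemma 22] -/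
theorem uniformlyProper_gprimeTorus_regG (hα : ∀ i, α i ≠ 0) (hS' : ∀ w, w ∈ S' → w ∈ splitChartPlaces L α)
    {c₀ : {w : InfinitePlace L // IsComplex w} → Fin 3 → ℝ} (hc₀ : c₀ ∈ ArchCartan.RegG S') :
    ∀ K ⊆ Set.pi Set.univ (fun w : {w : InfinitePlace L // IsComplex w} =>
        {cw : Fin 3 → ℝ | (w ∈ S' → cw 0 ≠ 0) ∧ (w ∉ S' → Function.Injective fun i : Fin 3 => Circle.exp (cw i))}), IsCompact K →
      ∀ C' : Set ↥(arch (↥(maximalRealSubfield L)) L (IsCMField.complexConj L) 3 (Matrix.diagonal α)), IsCompact C' →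
        ∃ 𝒦' : Set (↥(arch (↥(maximalRealSubfield L)) L (IsCMField.complexConj L) 3 (Matrix.diagonal α)) ⧸ Subgroup.centralizer ({gprimeTorus L α S' c₀} : Set ↥(arch (↥(maximalRealSubfield L)) L (IsCMField.complexConj L) 3 (Matrix.diagonal α)))),
          IsCompact 𝒦' ∧ ∀ c ∈ K, ∀ y' : ↥(arch (↥(maximalRealSubfield L)) L (IsCMField.complexConj L) 3 (Matrix.diagonal α)), y' * gprimeTorus L α S' c * y'⁻¹ ∈ C' →
            (QuotientGroup.mk y' : ↥(arch (↥(maximalRealSubfield L)) L (IsCMField.complexConj L) 3 (Matrix.diagonal α)) ⧸ Subgroup.centralizer ({gprimeTorus L α S' c₀} : Set ↥(arch (↥(maximalRealSubfield L)) L (IsCMField.complexConj L) 3 (Matrix.diagonal α)))) ∈ 𝒦' := by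
  refine uniformlyProper_gprimeTorus_of_regular L α S' hα c₀ (fun w hw => ((ArchCartan.mem_regG_iff S' c₀).1 hc₀).2 w hw.1) _ ?_ ?_
  · intro w hw cw hcw
    exact hcw.2 fun hwS => hw ⟨hwS, hS' w hwS⟩
  · intro w hw cw hcw
    exact hcw.1 hw.1

/-- **THE `Integrable` BINDER OF ★ D4b-2 AT EVERY REGULAR POINT OF EVERY ADMISSIBLE CHART**: for `S♯ ⊆ splitChartPlaces`, `c ∈ RegG S♯`, `a′ ∈ C_c(G′_∞)` and any measure `μ`
on `G′_∞ ⧸ T_{S♯}` finite on compacts, `descConj (gprimeTorus S♯ c) T_{S♯} a′` is integrable ((HYP) at the point, ED. 2 §; `Z(gprimeTorus S♯ c) = T_{S♯}` ★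
`chartTorusG_eq_centralizer`; ★ D3 §1). [cite: Rogawski1990, §8.3 p. 122; §4.3 p. 43] [cite: DeitmarEchterhoff2014, Lemma 9.3.3] [cite: HarishChandra1970, Part I §3 Lemma 22] -/
theorem integrable_descConj_gprimeTorus_of_regG (hα : ∀ i, α i ≠ 0) (hS' : ∀ w, w ∈ S' → w ∈ splitChartPlaces L α)
    {c : {w : InfinitePlace L // IsComplex w} → Fin 3 → ℝ} (hc : c ∈ ArchCartan.RegG S')
    {E : Type*} [NormedAddCommGroup E] [NormedSpace ℝ E] {a' : ↥(arch (↥(maximalRealSubfield L)) L (IsCMField.complexConj L) 3 (Matrix.diagonal α)) → E} (ha'c : Continuous a') (ha's : HasCompactSupport a')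
    [MeasurableSpace (↥(arch (↥(maximalRealSubfield L)) L (IsCMField.complexConj L) 3 (Matrix.diagonal α)) ⧸ chartTorusG L α S')] [OpensMeasurableSpace (↥(arch (↥(maximalRealSubfield L)) L (IsCMField.complexConj L) 3 (Matrix.diagonal α)) ⧸ chartTorusG L α S')]
    (μ : Measure (↥(arch (↥(maximalRealSubfield L)) L (IsCMField.complexConj L) 3 (Matrix.diagonal α)) ⧸ chartTorusG L α S')) [IsFiniteMeasureOnCompacts μ] :
    Integrable (descConj (gprimeTorus L α S' c) (chartTorusG L α S') (forall_mem_chartTorusG_comm L α S' c) a') μ := by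
  have hreg := (ArchCartan.mem_regG_iff S' c).1 hc
  have hK : ({c} : Set ({w : InfinitePlace L // IsComplex w} → Fin 3 → ℝ)) ⊆
      Set.pi Set.univ (fun w : {w : InfinitePlace L // IsComplex w} =>
        {cw : Fin 3 → ℝ | (w ∈ S' → cw 0 ≠ 0) ∧ (w ∉ S' → Function.Injective fun i : Fin 3 => Circle.exp (cw i))}) := by
    intro x hx w _
    rw [Set.mem_singleton_iff.1 hx]
    exact ⟨hreg.2 w, hreg.1 w⟩
  have h := uniformlyProper_gprimeTorus_regG L α S' hα hS' hc {c} hK isCompact_singleton (tsupport a') ha's.isCompact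
  rw [← chartTorusG_eq_centralizer L α S' hα hS' hc] at h
  obtain ⟨𝒦, h𝒦, hmem⟩ := h
  exact integrable_descConj_of_exists_isCompact (chartTorusG L α S') (isClosed_chartTorusG L α S') (gprimeTorus L α S' c)
    (forall_mem_chartTorusG_comm L α S' c) ha'c h𝒦 (fun y hy => hmem c (Set.mem_singleton c) y hy) μ

/-- **Group-level (HYP) at a regular point** — the uniform `hCM` binder of ★ D4b-2 on a `RegG S♯`-box `K` (one compact `C″` with `y′ ∈ C″ · Z(gprimeTorus c₀)` whenever
`y′ · gprimeTorus c · y′⁻¹ ∈ C′`, `c ∈ K`). [cite: Rogawski1990, §8.3 p. 122; §4.12 Lemma 4.12.1 p. 66] [cite: DeitmarEchterhoff2014, Remark 1.5.2] -/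
theorem exists_isCompact_mul_gprimeTorus_regG (hα : ∀ i, α i ≠ 0) (hS' : ∀ w, w ∈ S' → w ∈ splitChartPlaces L α)
    {c₀ : {w : InfinitePlace L // IsComplex w} → Fin 3 → ℝ} (hc₀ : c₀ ∈ ArchCartan.RegG S')
    {K : Set ({w : InfinitePlace L // IsComplex w} → Fin 3 → ℝ)}
    (hKS : K ⊆ Set.pi Set.univ (fun w : {w : InfinitePlace L // IsComplex w} =>
        {cw : Fin 3 → ℝ | (w ∈ S' → cw 0 ≠ 0) ∧ (w ∉ S' → Function.Injective fun i : Fin 3 => Circle.exp (cw i))}))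
    (hK : IsCompact K) {C' : Set ↥(arch (↥(maximalRealSubfield L)) L (IsCMField.complexConj L) 3 (Matrix.diagonal α))} (hC' : IsCompact C') :
    ∃ C'' : Set ↥(arch (↥(maximalRealSubfield L)) L (IsCMField.complexConj L) 3 (Matrix.diagonal α)), IsCompact C'' ∧ ∀ c ∈ K, ∀ y' : ↥(arch (↥(maximalRealSubfield L)) L (IsCMField.complexConj L) 3 (Matrix.diagonal α)), y' * gprimeTorus L α S' c * y'⁻¹ ∈ C' →
      y' ∈ (C'' * (Subgroup.centralizer ({gprimeTorus L α S' c₀} : Set ↥(arch (↥(maximalRealSubfield L)) L (IsCMField.complexConj L) 3 (Matrix.diagonal α)))) : Set ↥(arch (↥(maximalRealSubfield L)) L (IsCMField.complexConj L) 3 (Matrix.diagonal α))) := by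
  refine exists_isCompact_mul_gprimeTorus_of_regular L α S' hα c₀ (fun w hw => ((ArchCartan.mem_regG_iff S' c₀).1 hc₀).2 w hw.1) _ ?_ ?_ hKS hK hC'
  · intro w hw cw hcw
    exact hcw.2 fun hwS => hw ⟨hwS, hS' w hwS⟩
  · intro w hw cw hcw
    exact hcw.1 hw.1

end General

end Literature.NumberTheory.Rogawski1990
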